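import Mathlib.RingTheory.Valuation.Basic
import Mathlib.Algebra.Order.GroupWithZero.Canonical
import Mathlib.Tactic
import HarnessLib

/-!
# Cassels' second `3`-descent on `x³ + y³ + d z³ = 0`: the algebraic identities

Topic `NumberTheory/EllipticCurves`; namespace `Literature.NumberTheory.EllipticCurves.CasselsDescent`.
Everything PROVED; no named facts, no `sorry`.

J. W. S. Cassels, *Arithmetic on curves of genus 1. I. On a conjecture of Selmer*, J. reine angew.
Math. **202** (1959) 52–99 [Cassels1959ArithmeticI], studies the curve `C : x³ + y³ + d z³ = 0` over a
field `𝔎 ∋ ρ` (`ρ² + ρ + 1 = 0`, `τ = ρ − ρ²`, `τ² = −3`) through the two descent maps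
`m(𝔵) = (ρx + ρ²y)/(ρ²x + ρy)` (§4 (4)) and `μ(𝔵) = τ(y + zδ)/(x + y) ∈ 𝔇 = 𝔎(δ)`, `δ³ = d` (§5 (4));
*VI. The Tate–Šafarevič group can be arbitrarily large*, ibid. **214/215** (1964) 65–70
[Cassels1964ArithmeticVI], applies this machinery ("this paper should be regarded as an appendix to
[I]", p. 65) to `d = p₁⋯p_T q₁⋯q_I q_{I+1}`. This file isolates, over an ARBITRARY field `F` with a
root `ρ` of `X² + X + 1`, the finitely many polynomial identities on which that machinery runs, in
the form used by the tree's proof of Cassels' theorem (barrier file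
`Literature/Barriers/BirchSwinnertonDyer/DescentDefectUnboundedCasselsProofs.lean`):

* §4 Lemma 0, sums (5′): a point `(X, Y, Z)` of the torsor `m⁻¹X³ + mY³ + dZ³ = 0` gives the point
  `𝔵 = (x, y, z)` of `C` with `ρx + ρ²y = 3m⁻¹X³`, `ρ²x + ρy = 3mY³`, `x + y = 3dZ³`
  (`lemma0_u`, `lemma0_v`, `lemma0_w`, `lemma0_curve`);
* §5 Lemma 3 (p. 63): with `u = ρx + ρ²y`, `v = ρ²x + ρy`, `Norm(u + zδ) = u³ + dz³ = 3uxy`,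
  `Norm(v + zδ) = 3vxy` (`norm_u_add`, `norm_v_add`), and for `α = (u + ρzδ)/(v + ρ²zδ)`:
  `Norm α = u/v = m(𝔵)` and `α^{D−D²} = (y + δz)/(−x)`, whence `μ(𝔵) = l·α^{D−D²}`,
  `l = −τx/(x + y)` (`norm_alpha`, `D_alpha_div`, `mu_eq_l_mul`) — `D` being ANY ring endomorphism
  with `D δ = ρ δ` fixing `ρ, x, y, z` (in [I] the generator of `Gal(𝔇/𝔎)`);
* §5 Lemma 4 (p. 66), the step "by Hilbert's Satz 90": for a cyclic cubic operator `D` an explicit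
  Satz 90 — if `η · Dη · D²η = 1` then `η · D y = y` for one of the three EXPLICIT non-zero
  `y_i = δⁱ(1 + ρⁱη + ρ²ⁱ η Dη)` (`eta_mul_D_h90Witness`, `exists_h90Witness_ne_zero`) — and the
  resulting rewriting `α = cβ·Dγ/γ ⇒ α^{D−D²} = β^{D−D²} (D²γ)³ / Norm γ` (`D_ratio_of_eq`);
* §7 Lemma 7 (i) (pp. 70–71): for a valuation `v` with `v(3) = 1`, `a³ + b³ + c³ = 0`, `abc ≠ 0`,
  the three values `v(a + b), v(b + c), v(c + a)` agree modulo cubes (identity (13):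
  `(a + b + c)³ = 3(a + b)(b + c)(c + a)`), so `v(μ(𝔵)) ≡ 0 (mod 3)` (`lemma7`, `lemma7_mu`);
* §11 Lemma 13 (p. 87) = VI Lemma 1 (p. 67), in cube-root-free form: for `A B C = δ³`
  (`A = Δ`, `B = Δ^M`, `C = Δ^{M²}`, `Norm Δ = d = δ³`) put
  `Q_i = δA + ρⁱAC + ρ²ⁱδ²` (`= δA·τϑ_{?}/ω₁` of [I]) and `β = m^{1/3} Q₁/Q₂`; then
  `β^D = m^{1/3}Q₀/Q₁`, `β^{D²} = m^{1/3}Q₂/Q₀`, `Norm β = m` (`norm_lemma13Beta`), `β` is fixed by the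
  operator `M : m^{1/3} ↦ ρ m^{1/3}, A ↦ B ↦ C ↦ A` (`M_lemma13Beta`, identity `lemma13Q_M`), and with
  Cassels' `k = ϑ₁ϑ₂ϑ₃`, `τ³ d k = T − 3d`, `T = A²B + B²C + C²A` (`prod_lemma13Q`):
  `(T − 3d) · β^D/β^{D²} = Q₀³/(A²C)` (`Xi_eq`) — VI Lemma 2's "`lβ^{D−D²}` is a perfect ideal cube
  except possibly at primes dividing `τ` [and `d`]" made explicit.

All identities were certified by polynomial division (coefficients for `linear_combination`).

## References

* J. W. S. Cassels, *Arithmetic on curves of genus 1. I. On a conjecture of Selmer*, J. reine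
  angew. Math. 202 (1959), 52–99: §4 (4), Lemma 0; §5 (4), Lemma 3, Lemma 4; §7 Lemma 7;
  §11 Lemma 13. [Cassels1959ArithmeticI]
* J. W. S. Cassels, *Arithmetic on curves of genus 1. VI. The Tate–Šafarevič group can be
  arbitrarily large*, J. reine angew. Math. 214/215 (1964), 65–70: Lemma 1, Lemma 2.
  [Cassels1964ArithmeticVI]
-/

namespace Literature.NumberTheory.EllipticCurves

namespace CasselsDescent

variable {F : Type*} [Field F]

/-! ## The cube root of unity `ρ` and `τ = ρ − ρ²` -/

section RootOfUnity

variable {ρ : F}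

/-- `ρ³ = 1`. [folklore] -/
theorem rho_pow_three (hρ : ρ ^ 2 + ρ + 1 = 0) : ρ ^ 3 = 1 := by
  linear_combination (ρ - 1) * hρ

/-- `ρ ≠ 0`. [folklore] -/
theorem rho_ne_zero (hρ : ρ ^ 2 + ρ + 1 = 0) : ρ ≠ 0 := by
  rintro rfl
  norm_num at hρ

/-- `ρ ≠ 1` when `3 ≠ 0`. [folklore] -/
theorem rho_ne_one (hρ : ρ ^ 2 + ρ + 1 = 0) (h3 : (3 : F) ≠ 0) : ρ ≠ 1 := by
  rintro rfl
  apply h3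
  linear_combination hρ

/-- `τ² = −3` for `τ = ρ − ρ²` ([I] §4 (1), (2)). [cite: Cassels1959ArithmeticI, §4 (2)] -/
theorem tau_sq (hρ : ρ ^ 2 + ρ + 1 = 0) : (ρ - ρ ^ 2) ^ 2 = -3 := by
  linear_combination (ρ ^ 2 - 3 * ρ + 3) * hρ

/-- `τ ≠ 0` when `3 ≠ 0`. [folklore] -/
theorem tau_ne_zero (hρ : ρ ^ 2 + ρ + 1 = 0) (h3 : (3 : F) ≠ 0) : ρ - ρ ^ 2 ≠ 0 := by
  intro h
  apply h3
  have := tau_sq hρ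
  rw [h] at this
  linear_combination this

/-- `ρ^{3i} = 1`. [folklore] -/
theorem rho_pow_three_mul (hρ : ρ ^ 2 + ρ + 1 = 0) (i : ℕ) : ρ ^ (3 * i) = 1 := by
  rw [pow_mul, rho_pow_three hρ, one_pow]

/-- The master identity `(a + b + c)(a + ρb + ρ²c)(a + ρ²b + ρc) = a³ + b³ + c³ − 3abc`.
[folklore] -/
theorem prod_three_eq (hρ : ρ ^ 2 + ρ + 1 = 0) (a b c : F) :
    (a + b + c) * (a + ρ * b + ρ ^ 2 * c) * (a + ρ ^ 2 * b + ρ * c) =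
      a ^ 3 + b ^ 3 + c ^ 3 - 3 * a * b * c := by
  linear_combination ((-1) * c ^ 3 + (-1) * b ^ 3 + 3 * a * b * c + a ^ 2 * c + a ^ 2 * b +
    ρ * c ^ 3 + ρ * b ^ 3 + ρ * a * c ^ 2 + (-1) * ρ * a * b * c + ρ * a * b ^ 2 + ρ ^ 2 * b * c ^ 2 +
    ρ ^ 2 * b ^ 2 * c + ρ ^ 2 * a * b * c) * hρ

end RootOfUnity

/-! ## §4 Lemma 0: from the torsor `m⁻¹X³ + mY³ + dZ³ = 0` to the curve -/

section Lemma0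

variable {ρ m n X Y Z d x y : F}

/-- [I] §4 (5′), first sum: `ρx + ρ²y = 3m⁻¹X³` (`n = m⁻¹`).
[cite: Cassels1959ArithmeticI, §4 Lemma 0, (4′)–(5′)] -/
theorem lemma0_u (hρ : ρ ^ 2 + ρ + 1 = 0) (hT : n * X ^ 3 + m * Y ^ 3 + d * Z ^ 3 = 0)
    (hx : x = ρ ^ 2 * n * X ^ 3 + ρ * m * Y ^ 3 + d * Z ^ 3)
    (hy : y = ρ * n * X ^ 3 + ρ ^ 2 * m * Y ^ 3 + d * Z ^ 3) :
    ρ * x + ρ ^ 2 * y = 3 * n * X ^ 3 := by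
  subst hx hy
  linear_combination (Z ^ 3 * d + -2 * n * X ^ 3 + m * Y ^ 3 + 2 * ρ * n * X ^ 3 +
    (-1) * ρ * m * Y ^ 3 + ρ ^ 2 * m * Y ^ 3) * hρ + (-1) * hT

/-- [I] §4 (5′), second sum: `ρ²x + ρy = 3mY³`. [cite: Cassels1959ArithmeticI, §4 Lemma 0, (5′)] -/
theorem lemma0_v (hρ : ρ ^ 2 + ρ + 1 = 0) (hT : n * X ^ 3 + m * Y ^ 3 + d * Z ^ 3 = 0)
    (hx : x = ρ ^ 2 * n * X ^ 3 + ρ * m * Y ^ 3 + d * Z ^ 3)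
    (hy : y = ρ * n * X ^ 3 + ρ ^ 2 * m * Y ^ 3 + d * Z ^ 3) :
    ρ ^ 2 * x + ρ * y = 3 * m * Y ^ 3 := by
  subst hx hy
  linear_combination (Z ^ 3 * d + n * X ^ 3 + -2 * m * Y ^ 3 + (-1) * ρ * n * X ^ 3 +
    2 * ρ * m * Y ^ 3 + ρ ^ 2 * n * X ^ 3) * hρ + (-1) * hT

/-- [I] §4 (5′), third sum: `x + y = 3dZ³`. [cite: Cassels1959ArithmeticI, §4 Lemma 0, (5′)] -/
theorem lemma0_w (hρ : ρ ^ 2 + ρ + 1 = 0) (hT : n * X ^ 3 + m * Y ^ 3 + d * Z ^ 3 = 0)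
    (hx : x = ρ ^ 2 * n * X ^ 3 + ρ * m * Y ^ 3 + d * Z ^ 3)
    (hy : y = ρ * n * X ^ 3 + ρ ^ 2 * m * Y ^ 3 + d * Z ^ 3) :
    x + y = 3 * d * Z ^ 3 := by
  subst hx hy
  linear_combination (n * X ^ 3 + m * Y ^ 3) * hρ + (-1) * hT

/-- `(x + y)(ρx + ρ²y)(ρ²x + ρy) = x³ + y³`. [folklore] -/
theorem sum_mul_u_mul_v (hρ : ρ ^ 2 + ρ + 1 = 0) (x y : F) :
    (x + y) * (ρ * x + ρ ^ 2 * y) * (ρ ^ 2 * x + ρ * y) = x ^ 3 + y ^ 3 := by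
  linear_combination ((-1) * y ^ 3 + (-1) * x ^ 3 + ρ * y ^ 3 + ρ * x ^ 3 + ρ ^ 2 * x * y ^ 2 +
    ρ ^ 2 * x ^ 2 * y) * hρ

/-- [I] §4 Lemma 0: "on multiplying, `x³ + y³ = 27dX³Y³Z³ = −dz³`, so `𝔵` is on `C`" with
`z = −3XYZ`. [cite: Cassels1959ArithmeticI, §4 Lemma 0] -/
theorem lemma0_curve (hρ : ρ ^ 2 + ρ + 1 = 0) (hT : n * X ^ 3 + m * Y ^ 3 + d * Z ^ 3 = 0)
    (hmn : m * n = 1)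
    (hx : x = ρ ^ 2 * n * X ^ 3 + ρ * m * Y ^ 3 + d * Z ^ 3)
    (hy : y = ρ * n * X ^ 3 + ρ ^ 2 * m * Y ^ 3 + d * Z ^ 3) {z : F} (hz : z = -3 * X * Y * Z) :
    x ^ 3 + y ^ 3 + d * z ^ 3 = 0 := by
  have hu := lemma0_u hρ hT hx hy
  have hv := lemma0_v hρ hT hx hy
  have hw := lemma0_w hρ hT hx hy
  have hprod := sum_mul_u_mul_v hρ x y
  rw [hu, hv, hw] at hprod
  rw [← hprod, hz]
  linear_combination ((27 : F) * d * X ^ 3 * Y ^ 3 * Z ^ 3) * hmn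

end Lemma0

/-! ## §5 Lemma 3: the norms of `u + zδ`, `v + zδ` and the element `α` -/

section Lemma3

variable {ρ x y w : F}

/-- `(ρx + ρ²y)(ρ²x + ρy) = x² − xy + y²`. [folklore] -/
theorem u_mul_v (hρ : ρ ^ 2 + ρ + 1 = 0) (x y : F) :
    (ρ * x + ρ ^ 2 * y) * (ρ ^ 2 * x + ρ * y) = x ^ 2 - x * y + y ^ 2 := by
  linear_combination ((-1) * y ^ 2 + x * y + (-1) * x ^ 2 + ρ * y ^ 2 + (-1) * ρ * x * y +
    ρ * x ^ 2 + ρ ^ 2 * x * y) * hρ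

/-- `u³ = x³ + y³ + 3uxy` for `u = ρx + ρ²y`. [cite: Cassels1959ArithmeticI, §5 p. 63] -/
theorem u_pow_three (hρ : ρ ^ 2 + ρ + 1 = 0) (x y : F) :
    (ρ * x + ρ ^ 2 * y) ^ 3 = x ^ 3 + y ^ 3 + 3 * (ρ * x + ρ ^ 2 * y) * x * y := by
  linear_combination ((-1) * y ^ 3 + (-1) * x ^ 3 + ρ * y ^ 3 + -3 * ρ * x ^ 2 * y + ρ * x ^ 3 +
    -3 * ρ ^ 2 * x * y ^ 2 + 3 * ρ ^ 2 * x ^ 2 * y + (-1) * ρ ^ 3 * y ^ 3 + 3 * ρ ^ 3 * x * y ^ 2 +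
    ρ ^ 4 * y ^ 3) * hρ

/-- `v³ = x³ + y³ + 3vxy` for `v = ρ²x + ρy`. [cite: Cassels1959ArithmeticI, §5 p. 63] -/
theorem v_pow_three (hρ : ρ ^ 2 + ρ + 1 = 0) (x y : F) :
    (ρ ^ 2 * x + ρ * y) ^ 3 = x ^ 3 + y ^ 3 + 3 * (ρ ^ 2 * x + ρ * y) * x * y := by
  linear_combination ((-1) * y ^ 3 + (-1) * x ^ 3 + ρ * y ^ 3 + -3 * ρ * x * y ^ 2 + ρ * x ^ 3 +
    3 * ρ ^ 2 * x * y ^ 2 + -3 * ρ ^ 2 * x ^ 2 * y + 3 * ρ ^ 3 * x ^ 2 * y + (-1) * ρ ^ 3 * x ^ 3 +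
    ρ ^ 4 * x ^ 3) * hρ

/-- **[I] §5, p. 63: `Norm Φ = u³ + dz³ = u³ − x³ − y³ = 3uxy`** for `Φ = u + zδ`, written with
`w = zδ` (so `w³ = dz³` and the curve is `x³ + y³ + w³ = 0`):
`(u + w)(u + ρw)(u + ρ²w) = 3uxy`. [cite: Cassels1959ArithmeticI, §5 Lemma 3 (proof, p. 63)] -/
theorem norm_u_add (hρ : ρ ^ 2 + ρ + 1 = 0) (hC : x ^ 3 + y ^ 3 + w ^ 3 = 0) :
    (ρ * x + ρ ^ 2 * y + w) * (ρ * x + ρ ^ 2 * y + ρ * w) * (ρ * x + ρ ^ 2 * y + ρ ^ 2 * w) =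
      3 * (ρ * x + ρ ^ 2 * y) * x * y := by
  linear_combination ((-1) * w ^ 3 + (-1) * y ^ 3 + (-1) * x ^ 3 + ρ * w ^ 3 + ρ * y ^ 3 +
    -3 * ρ * x ^ 2 * y + ρ * x ^ 3 + ρ ^ 2 * x * w ^ 2 + -3 * ρ ^ 2 * x * y ^ 2 + ρ ^ 2 * x ^ 2 * w +
    3 * ρ ^ 2 * x ^ 2 * y + ρ ^ 3 * y * w ^ 2 + (-1) * ρ ^ 3 * y ^ 3 + 2 * ρ ^ 3 * x * y * w +
    3 * ρ ^ 3 * x * y ^ 2 + ρ ^ 4 * y ^ 2 * w + ρ ^ 4 * y ^ 3) * hρ + (1 : F) * hC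

/-- **[I] §5, p. 63: `Norm Ψ = 3vxy`** for `Ψ = v + zδ`:
`(v + w)(v + ρw)(v + ρ²w) = 3vxy`. [cite: Cassels1959ArithmeticI, §5 Lemma 3 (proof, p. 63)] -/
theorem norm_v_add (hρ : ρ ^ 2 + ρ + 1 = 0) (hC : x ^ 3 + y ^ 3 + w ^ 3 = 0) :
    (ρ ^ 2 * x + ρ * y + w) * (ρ ^ 2 * x + ρ * y + ρ * w) * (ρ ^ 2 * x + ρ * y + ρ ^ 2 * w) =
      3 * (ρ ^ 2 * x + ρ * y) * x * y := by
  linear_combination ((-1) * w ^ 3 + (-1) * y ^ 3 + (-1) * x ^ 3 + ρ * w ^ 3 + ρ * y ^ 3 +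
    -3 * ρ * x * y ^ 2 + ρ * x ^ 3 + ρ ^ 2 * y * w ^ 2 + ρ ^ 2 * y ^ 2 * w + 3 * ρ ^ 2 * x * y ^ 2 +
    -3 * ρ ^ 2 * x ^ 2 * y + ρ ^ 3 * x * w ^ 2 + 2 * ρ ^ 3 * x * y * w + 3 * ρ ^ 3 * x ^ 2 * y +
    (-1) * ρ ^ 3 * x ^ 3 + ρ ^ 4 * x ^ 2 * w + ρ ^ 4 * x ^ 3) * hρ + (1 : F) * hC

/-- **[I] §5, p. 63: "It is then readily verified that `α^{D−D²} = (v + ρzδ)(u + ρ²zδ)/((v + zδ)(u + zδ))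
= (y + δz)/(−x)` on multiplying by the denominators and using `δ³ = d`, `x³ + y³ + dz³ = 0`."**
Polynomial form (`w = zδ`). [cite: Cassels1959ArithmeticI, §5 Lemma 3 (proof, p. 63)] -/
theorem key_identity (hρ : ρ ^ 2 + ρ + 1 = 0) (hC : x ^ 3 + y ^ 3 + w ^ 3 = 0) :
    (ρ * x + ρ ^ 2 * y + ρ ^ 2 * w) * (ρ ^ 2 * x + ρ * y + ρ * w) * (-x) =
      (y + w) * (ρ ^ 2 * x + ρ * y + w) * (ρ * x + ρ ^ 2 * y + w) := by
  linear_combination ((-1) * y * w ^ 2 + y ^ 3 + x ^ 3 + (-1) * ρ * y ^ 2 * w + (-1) * ρ * y ^ 3 +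
    (-1) * ρ * x * w ^ 2 + (-1) * ρ * x * y * w + (-1) * ρ * x ^ 3 + (-1) * ρ ^ 2 * x * y * w +
    (-1) * ρ ^ 2 * x * y ^ 2 + (-1) * ρ ^ 2 * x ^ 2 * w + (-1) * ρ ^ 2 * x ^ 2 * y) * hρ + (-1 : F) * hC

end Lemma3

/-! ## The operator `D` (`δ ↦ ρδ`) and Cassels' `α`, `μ`, `l` -/

section Alpha

variable {ρ δ x y z : F} (D : F →+* F)

/-- If `D` fixes `a, b` with `b ≠ 0` but moves `δ ≠ 0` to `ρδ`, `ρ ≠ 1`, then `a + bδ ≠ 0`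
(otherwise `δ = −a/b` would be fixed). [folklore] -/
theorem add_mul_delta_ne_zero (hDδ : D δ = ρ * δ) (hρ1 : ρ ≠ 1) (hδ : δ ≠ 0) {a b : F}
    (hDa : D a = a) (hDb : D b = b) (hb : b ≠ 0) : a + b * δ ≠ 0 := by
  intro h
  have h1 : D (a + b * δ) = 0 := by rw [h, map_zero]
  rw [map_add, map_mul, hDa, hDb, hDδ] at h1
  have h2 : b * δ * (ρ - 1) = 0 := by linear_combination h1 - h
  rcases mul_eq_zero.mp h2 with h3 | h3
  · exact mul_ne_zero hb hδ h3
  · exact hρ1 (sub_eq_zero.mp h3)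

variable (ρ δ x y z) in
/-- Cassels' `α = Φ^D/Ψ^{D²} = (u + ρzδ)/(v + ρ²zδ)`, `u = ρx + ρ²y`, `v = ρ²x + ρy`
([I] §5, p. 63). [cite: Cassels1959ArithmeticI, §5 Lemma 3 (proof, p. 63)] -/
def alpha : F := (ρ * x + ρ ^ 2 * y + ρ * z * δ) / (ρ ^ 2 * x + ρ * y + ρ ^ 2 * z * δ)

section

variable (hρ : ρ ^ 2 + ρ + 1 = 0) (hDρ : D ρ = ρ) (hDδ : D δ = ρ * δ) (hDx : D x = x) (hDy : D y = y)
  (hDz : D z = z)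
include hρ hDρ hDδ hDx hDy hDz

/-- `D α = (u + ρ²zδ)/(v + zδ)`. [cite: Cassels1959ArithmeticI, §5 Lemma 3 (proof, p. 63)] -/
theorem D_alpha : D (alpha ρ δ x y z) = (ρ * x + ρ ^ 2 * y + ρ ^ 2 * z * δ) / (ρ ^ 2 * x + ρ * y + z * δ) := by
  have h3 := rho_pow_three hρ
  simp only [alpha, map_div₀, map_add, map_mul, map_pow, hDρ, hDδ, hDx, hDy, hDz]
  congr 1
  · ring
  · have : ρ ^ 2 * z * (ρ * δ) = ρ ^ 3 * (z * δ) := by ring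
    rw [this, h3, one_mul]

/-- `D (D α) = (u + zδ)/(v + ρzδ)`. [cite: Cassels1959ArithmeticI, §5 Lemma 3 (proof, p. 63)] -/
theorem D_D_alpha : D (D (alpha ρ δ x y z)) = (ρ * x + ρ ^ 2 * y + z * δ) / (ρ ^ 2 * x + ρ * y + ρ * z * δ) := by
  have h3 := rho_pow_three hρ
  rw [D_alpha D hρ hDρ hDδ hDx hDy hDz]
  simp only [map_div₀, map_add, map_mul, map_pow, hDρ, hDδ, hDx, hDy, hDz]
  congr 1
  · have : ρ ^ 2 * z * (ρ * δ) = ρ ^ 3 * (z * δ) := by ring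
    rw [this, h3, one_mul]
  · ring

/-- **[I] §5, p. 64: `Norm α = Norm Φ/Norm Ψ = u/v`**, i.e. `α · Dα · D²α = (ρx + ρ²y)/(ρ²x + ρy)`
(which is `m(𝔵)`), for `z ≠ 0`, `v ≠ 0`, `δ ≠ 0`, `3 ≠ 0`, `δ³ = d`, `x³ + y³ + dz³ = 0`.
[cite: Cassels1959ArithmeticI, §5 Lemma 3 (proof, pp. 63–64)] -/
theorem norm_alpha (h3 : (3 : F) ≠ 0) (hδ : δ ≠ 0) (hz : z ≠ 0)
    {d : F} (hd : δ ^ 3 = d) (hC : x ^ 3 + y ^ 3 + d * z ^ 3 = 0)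
    (hv : ρ ^ 2 * x + ρ * y ≠ 0) :
    alpha ρ δ x y z * D (alpha ρ δ x y z) * D (D (alpha ρ δ x y z)) =
      (ρ * x + ρ ^ 2 * y) / (ρ ^ 2 * x + ρ * y) := by
  have hρ1 := rho_ne_one hρ h3
  have hr3 := rho_pow_three hρ
  have hC' : x ^ 3 + y ^ 3 + (z * δ) ^ 3 = 0 := by rw [mul_pow, hd]; linear_combination hC
  have hNu := norm_u_add hρ hC'
  have hNv := norm_v_add hρ hC'
  -- the three denominators are non-zero
  have hDv : D (ρ ^ 2 * x + ρ * y) = ρ ^ 2 * x + ρ * y := by simp [hDρ, hDx, hDy]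
  have hden0 : ρ ^ 2 * x + ρ * y + z * δ ≠ 0 := add_mul_delta_ne_zero D hDδ hρ1 hδ hDv hDz hz
  have hden1 : ρ ^ 2 * x + ρ * y + ρ * z * δ ≠ 0 :=
    add_mul_delta_ne_zero D hDδ hρ1 hδ hDv (by simp [hDρ, hDz]) (mul_ne_zero (rho_ne_zero hρ) hz)
  have hden2 : ρ ^ 2 * x + ρ * y + ρ ^ 2 * z * δ ≠ 0 :=
    add_mul_delta_ne_zero D hDδ hρ1 hδ hDv (by simp [hDρ, hDz])
      (mul_ne_zero (pow_ne_zero _ (rho_ne_zero hρ)) hz)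
  rw [D_D_alpha D hρ hDρ hDδ hDx hDy hDz, D_alpha D hρ hDρ hDδ hDx hDy hDz, alpha]
  rw [div_mul_div_comm, div_mul_div_comm, div_eq_div_iff (mul_ne_zero (mul_ne_zero hden2 hden0) hden1) hv]
  have e1 : (ρ * x + ρ ^ 2 * y + ρ * z * δ) * (ρ * x + ρ ^ 2 * y + ρ ^ 2 * z * δ) *
      (ρ * x + ρ ^ 2 * y + z * δ) = 3 * (ρ * x + ρ ^ 2 * y) * x * y := by
    rw [← hNu]; ring
  have e2 : (ρ ^ 2 * x + ρ * y + ρ ^ 2 * z * δ) * (ρ ^ 2 * x + ρ * y + z * δ) *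
      (ρ ^ 2 * x + ρ * y + ρ * z * δ) = 3 * (ρ ^ 2 * x + ρ * y) * x * y := by
    rw [← hNv]; ring
  rw [e1, e2]
  ring

/-- **[I] §5, p. 63: `α^{D−D²} = (y + δz)/(−x)`**, i.e. `Dα / D²α = (y + δz)/(−x)` (`xz ≠ 0`,
`δ ≠ 0`, `3 ≠ 0`). [cite: Cassels1959ArithmeticI, §5 Lemma 3 (proof, p. 63)] -/
theorem D_alpha_div (h3 : (3 : F) ≠ 0) (hδ : δ ≠ 0) (hx : x ≠ 0) (hz : z ≠ 0)
    {d : F} (hd : δ ^ 3 = d) (hC : x ^ 3 + y ^ 3 + d * z ^ 3 = 0)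
    (hu0 : ρ * x + ρ ^ 2 * y + z * δ ≠ 0) :
    D (alpha ρ δ x y z) / D (D (alpha ρ δ x y z)) = (y + δ * z) / (-x) := by
  have hρ1 := rho_ne_one hρ h3
  have hC' : x ^ 3 + y ^ 3 + (z * δ) ^ 3 = 0 := by rw [mul_pow, hd]; linear_combination hC
  have hkey := key_identity hρ hC'
  have hDv : D (ρ ^ 2 * x + ρ * y) = ρ ^ 2 * x + ρ * y := by simp [hDρ, hDx, hDy]
  have hden0 : ρ ^ 2 * x + ρ * y + z * δ ≠ 0 := add_mul_delta_ne_zero D hDδ hρ1 hδ hDv hDz hz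
  have hden1 : ρ ^ 2 * x + ρ * y + ρ * z * δ ≠ 0 :=
    add_mul_delta_ne_zero D hDδ hρ1 hδ hDv (by simp [hDρ, hDz]) (mul_ne_zero (rho_ne_zero hρ) hz)
  rw [D_D_alpha D hρ hDρ hDδ hDx hDy hDz, D_alpha D hρ hDρ hDδ hDx hDy hDz,
    div_div_div_eq, div_eq_div_iff (mul_ne_zero hden0 hu0) (neg_ne_zero.mpr hx)]
  linear_combination hkey

/-- **[I] §5, p. 63: `μ(𝔵) = τ(y + δz)/(x + y) = l α^{D−D²}` with `l = −τx/(x + y)`.**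
[cite: Cassels1959ArithmeticI, §5 Lemma 3 (proof, p. 63)] -/
theorem mu_eq_l_mul (h3 : (3 : F) ≠ 0) (hδ : δ ≠ 0) (hx : x ≠ 0) (hz : z ≠ 0)
    {d : F} (hd : δ ^ 3 = d) (hC : x ^ 3 + y ^ 3 + d * z ^ 3 = 0)
    (hu0 : ρ * x + ρ ^ 2 * y + z * δ ≠ 0) :
    (ρ - ρ ^ 2) * (y + z * δ) / (x + y) =
      (-(ρ - ρ ^ 2) * x / (x + y)) * (D (alpha ρ δ x y z) / D (D (alpha ρ δ x y z))) := by
  have hxy : x + y ≠ 0 := by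
    intro h
    have hy : y = -x := by linear_combination h
    have h0 : (δ * z) ^ 3 = 0 := by rw [mul_pow, hd]; rw [hy] at hC; linear_combination hC
    exact mul_ne_zero hδ hz (pow_eq_zero_iff (n := 3) (by norm_num) |>.mp h0)
  rw [D_alpha_div D hρ hDρ hDδ hDx hDy hDz h3 hδ hx hz hd hC hu0, div_mul_div_comm,
    div_eq_div_iff hxy (mul_ne_zero hxy (neg_ne_zero.mpr hx))]
  ring

end

end Alpha

/-! ## §5 Lemma 4: an explicit Satz 90 for a cubic operator, and the rewriting of `α^{D−D²}` -/

section Satz90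

variable {ρ δ η η' : F}

variable (ρ δ η η') in
/-- The three candidate solutions `y_i = δⁱ (1 + ρⁱ η + ρ²ⁱ η η')` (`η'` standing for `Dη`) of
`η · D y = y`. [folklore] -/
def h90Witness (i : ℕ) : F := δ ^ i * (1 + ρ ^ i * η + ρ ^ (2 * i) * η * η')

/-- **Satz 90 for the cubic operator `D` ([I] §5, proof of Lemma 4: "By Hilbert's Satz 90, there is
a `ξ` such that `α = hβξ^{D−D²}`"), explicit form.** If `D` is a ring endomorphism with `Dρ = ρ`,
`Dδ = ρδ` and `η · Dη · D²η = 1`, then `η · D(y_i) = y_i` for each `i`.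
[cite: Cassels1959ArithmeticI, §5 Lemma 4 (proof)] -/
theorem eta_mul_D_h90Witness (D : F →+* F) (hρ : ρ ^ 2 + ρ + 1 = 0) (hDρ : D ρ = ρ) (hDδ : D δ = ρ * δ)
    (hN : η * D η * D (D η) = 1) (i : ℕ) :
    η * D (h90Witness ρ δ η (D η) i) = h90Witness ρ δ η (D η) i := by
  have h3i := rho_pow_three_mul hρ i
  simp only [h90Witness, map_mul, map_add, map_one, map_pow, hDρ, hDδ]
  have : (ρ * δ) ^ i = ρ ^ i * δ ^ i := mul_pow _ _ _
  rw [this]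
  have e : ρ ^ (2 * i) * ρ ^ i = 1 := by rw [← pow_add, show 2 * i + i = 3 * i by ring, h3i]
  linear_combination (ρ ^ i * δ ^ i * ρ ^ (2 * i)) * hN + (δ ^ i) * e

/-- One of the three witnesses is non-zero (their weighted sum is `3δ^?`: precisely
`y₀ + δ⁻¹y₁ + δ⁻²y₂ = 3`), provided `3 ≠ 0` and `δ ≠ 0`. [folklore] -/
theorem exists_h90Witness_ne_zero (hρ : ρ ^ 2 + ρ + 1 = 0) (h3 : (3 : F) ≠ 0) (hδ : δ ≠ 0) :
    ∃ i < 3, h90Witness ρ δ η η' i ≠ 0 := by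
  by_contra h
  simp only [not_exists, not_and, not_not] at h
  have h0 : 1 + η + η * η' = 0 := by
    have := h 0 (by norm_num); simp only [h90Witness, pow_zero, mul_zero, one_mul] at this; exact this
  have h1 : 1 + ρ * η + ρ ^ 2 * η * η' = 0 := by
    have := h 1 (by norm_num)
    simp only [h90Witness, pow_one, mul_one] at this
    rcases mul_eq_zero.mp this with h' | h'
    · exact absurd h' hδ
    · exact h'
  have h2 : 1 + ρ ^ 2 * η + ρ ^ 4 * η * η' = 0 := by
    have := h 2 (by norm_num)
    simp only [h90Witness, show 2 * 2 = 4 from rfl] at this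
    rcases mul_eq_zero.mp this with h' | h'
    · exact absurd (pow_eq_zero_iff (n := 2) (by norm_num) |>.mp h') hδ
    · exact h'
  apply h3
  linear_combination h0 + h1 + h2 - (η + η * η' + (-1) * ρ * η * η' + ρ ^ 2 * η * η') * hρ

/-- The witnesses are fixed by every ring endomorphism fixing `ρ, δ, η, η'`. [folklore] -/
theorem map_h90Witness (σ : F →+* F) (hσρ : σ ρ = ρ) (hσδ : σ δ = δ) (hση : σ η = η)
    (hση' : σ η' = η') (i : ℕ) : σ (h90Witness ρ δ η η' i) = h90Witness ρ δ η η' i := by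
  simp only [h90Witness, map_mul, map_add, map_one, map_pow, hσρ, hσδ, hση, hση']

/-- **[I] §5 Lemma 4, the computation "`α^{D−D²} = h (Norm ξ) β^{D−D²} ξ⁻³`", in the form used
here:** if `D³ = 1`, `α = c β (Dγ/γ)` with `Dc = c`, then
`Dα/D²α = (Dβ/D²β) · (D²γ)³/(γ · Dγ · D²γ)`. [cite: Cassels1959ArithmeticI, §5 Lemma 4 (proof)] -/
theorem D_ratio_of_eq (D : F →+* F) (hD3 : ∀ t, D (D (D t)) = t) {α c β γ : F} (hDc : D c = c)
    (hc : c ≠ 0) (hβ : β ≠ 0) (hγ : γ ≠ 0) (h : α = c * β * (D γ / γ)) :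
    D α / D (D α) = D β / D (D β) * D (D γ) ^ 3 / (γ * D γ * D (D γ)) := by
  have hDβ : D β ≠ 0 := (map_ne_zero D).mpr hβ
  have hDDβ : D (D β) ≠ 0 := (map_ne_zero D).mpr hDβ
  have hDγ : D γ ≠ 0 := (map_ne_zero D).mpr hγ
  have hDDγ : D (D γ) ≠ 0 := (map_ne_zero D).mpr hDγ
  subst h
  simp only [map_mul, map_div₀, hDc, hD3]
  field_simp

end Satz90

/-! ## §11 Lemma 13 / VI Lemma 1: the explicit `β` with `Norm β = m` -/

section Lemma13

variable {ρ δ A B C μ : F}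

variable (ρ δ) in
/-- `Q_i(A, C) = δA + ρⁱ A C + ρ²ⁱ δ²` — Cassels' `τ ϑ` cleared of the cube root `ω₁`
(`ω₁³ = A/C`): `τϑ₁ : τϑ₂ : τϑ₃ = Q₀ : Q₁ : Q₂` ([I] §11 Lemma 13; VI Lemma 1).
[cite: Cassels1964ArithmeticVI, Lemma 1] -/
def lemma13Q (A C : F) (i : ℕ) : F := δ * A + ρ ^ i * A * C + ρ ^ (2 * i) * δ ^ 2

/-- **VI Lemma 1, `k = ϑ₁ϑ₂ϑ₃ ∈ ℚ(ρ)` made explicit:** `Q₀Q₁Q₂ = A²C (T − 3ABC)` with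
`T = A²B + B²C + C²A` (`= Tr Δ²Δ^M`), when `ABC = δ³`. [cite: Cassels1964ArithmeticVI, Lemma 1 (15)] -/
theorem prod_lemma13Q (hρ : ρ ^ 2 + ρ + 1 = 0) (hN : A * B * C = δ ^ 3) :
    lemma13Q ρ δ A C 0 * lemma13Q ρ δ A C 1 * lemma13Q ρ δ A C 2 =
      A ^ 2 * C * (A ^ 2 * B + B ^ 2 * C + C ^ 2 * A - 3 * A * B * C) := by
  simp only [lemma13Q, pow_zero, mul_zero, one_mul, mul_one, pow_one]
  linear_combination ((-1) * A ^ 3 * C ^ 3 + δ ^ 2 * A ^ 3 * C + 3 * δ ^ 3 * A ^ 2 * C + δ ^ 4 * A ^ 2 +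
    (-1) * δ ^ 6 + ρ * A ^ 3 * C ^ 3 + ρ * δ * A ^ 3 * C ^ 2 + -2 * ρ * δ ^ 3 * A ^ 2 * C +
    (-1) * ρ * δ ^ 4 * A ^ 2 + ρ * δ ^ 6 + ρ ^ 2 * δ ^ 3 * A ^ 2 * C + ρ ^ 2 * δ ^ 4 * A ^ 2 +
    ρ ^ 2 * δ ^ 5 * A + ρ ^ 3 * δ ^ 2 * A ^ 2 * C ^ 2 + ρ ^ 3 * δ ^ 3 * A ^ 2 * C +
    (-1) * ρ ^ 3 * δ ^ 5 * A + (-1) * ρ ^ 3 * δ ^ 6 + ρ ^ 4 * δ ^ 4 * A * C + ρ ^ 4 * δ ^ 5 * A +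
    ρ ^ 4 * δ ^ 6) * hρ + ((-1) * A * B * C + 3 * A ^ 2 * C + (-1) * A ^ 3 + (-1) * δ ^ 3) * hN

/-- **The `M`-invariance identity** behind "`β ∈ ℚ(ρ, d^{1/3})`" (VI Lemma 1, [I] Lemma 13): under
`A ↦ B`, `C ↦ A` (and `m^{1/3} ↦ ρ m^{1/3}`) one has `ρ · Q₁(B, A) · Q₂(A, C) = Q₁(A, C) · Q₂(B, A)`
when `ABC = δ³`. [cite: Cassels1964ArithmeticVI, Lemma 1] -/
theorem lemma13Q_M (hρ : ρ ^ 2 + ρ + 1 = 0) (hN : A * B * C = δ ^ 3) :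
    ρ * lemma13Q ρ δ B A 1 * lemma13Q ρ δ A C 2 = lemma13Q ρ δ A C 1 * lemma13Q ρ δ B A 2 := by
  simp only [lemma13Q, mul_one, pow_one]
  linear_combination (A ^ 2 * B * C + (-1) * δ * A * B * C + (-1) * δ ^ 2 * A * B + (-1) * δ ^ 3 * A +
    δ ^ 4 + -2 * ρ * A ^ 2 * B * C + ρ * δ * A * B * C + 2 * ρ * δ ^ 2 * A * B + 2 * ρ * δ ^ 3 * A +
    -2 * ρ * δ ^ 4 + ρ ^ 2 * A ^ 2 * B * C + (-1) * ρ ^ 2 * δ ^ 2 * A * B + (-1) * ρ ^ 2 * δ ^ 3 * B +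
    (-1) * ρ ^ 2 * δ ^ 3 * A + ρ ^ 2 * δ ^ 4 + (-1) * ρ ^ 3 * δ ^ 2 * A * B + ρ ^ 3 * δ ^ 3 * B +
    ρ ^ 3 * δ ^ 4 + ρ ^ 4 * δ ^ 2 * A * B + -2 * ρ ^ 4 * δ ^ 4 + ρ ^ 5 * δ ^ 4) * hρ +
    ((-1) * A + δ + ρ * A + (-1) * ρ * δ) * hN

/-- `D`-shifts: `Q₀(ρδ) = ρ Q₂(δ)`. [folklore] -/
theorem lemma13Q_D_zero (hρ : ρ ^ 2 + ρ + 1 = 0) (A C : F) :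
    lemma13Q ρ (ρ * δ) A C 0 = ρ * lemma13Q ρ δ A C 2 := by
  simp only [lemma13Q, pow_zero, mul_zero, one_mul]
  linear_combination (A * C + (-1) * ρ * A * C + ρ ^ 2 * δ ^ 2 + (-1) * ρ ^ 3 * δ ^ 2) * hρ

/-- `D`-shifts: `Q₁(ρδ) = ρ Q₀(δ)`. [folklore] -/
theorem lemma13Q_D_one (hρ : ρ ^ 2 + ρ + 1 = 0) (A C : F) :
    lemma13Q ρ (ρ * δ) A C 1 = ρ * lemma13Q ρ δ A C 0 := by
  simp only [lemma13Q, pow_zero, mul_zero, one_mul, mul_one, pow_one]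
  linear_combination ((-1) * ρ * δ ^ 2 + ρ ^ 2 * δ ^ 2) * hρ

/-- `D`-shifts: `Q₂(ρδ) = ρ Q₁(δ)`. [folklore] -/
theorem lemma13Q_D_two (hρ : ρ ^ 2 + ρ + 1 = 0) (A C : F) :
    lemma13Q ρ (ρ * δ) A C 2 = ρ * lemma13Q ρ δ A C 1 := by
  simp only [lemma13Q, mul_one, pow_one]
  linear_combination ((-1) * ρ ^ 3 * δ ^ 2 + ρ ^ 4 * δ ^ 2) * hρ

/-- If `A, C ≠ 0` and `T − 3ABC ≠ 0` then all three `Q_i ≠ 0` (from `prod_lemma13Q`) — this is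
Cassels' proviso "Suppose that `k ≠ 0`" (VI Lemma 1). [cite: Cassels1964ArithmeticVI, Lemma 1] -/
theorem lemma13Q_ne_zero (hρ : ρ ^ 2 + ρ + 1 = 0) (hN : A * B * C = δ ^ 3) (hA : A ≠ 0) (hC : C ≠ 0)
    (hT : A ^ 2 * B + B ^ 2 * C + C ^ 2 * A - 3 * A * B * C ≠ 0) :
    lemma13Q ρ δ A C 0 ≠ 0 ∧ lemma13Q ρ δ A C 1 ≠ 0 ∧ lemma13Q ρ δ A C 2 ≠ 0 := by
  have h := prod_lemma13Q hρ hN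
  have hne : lemma13Q ρ δ A C 0 * lemma13Q ρ δ A C 1 * lemma13Q ρ δ A C 2 ≠ 0 := by
    rw [h]; exact mul_ne_zero (mul_ne_zero (pow_ne_zero _ hA) hC) hT
  refine ⟨fun h0 => hne ?_, fun h1 => hne ?_, fun h2 => hne ?_⟩
  · rw [h0, zero_mul, zero_mul]
  · rw [h1, mul_zero, zero_mul]
  · rw [h2, mul_zero]

variable (ρ δ A C μ) in
/-- **Cassels' `β = m^{1/3} ϑ₂/ϑ₃`** in cube-root-free form: `β = μ Q₁/Q₂` (`μ = m^{1/3}`).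
[cite: Cassels1964ArithmeticVI, Lemma 1] [cite: Cassels1959ArithmeticI, §11 Lemma 13 (12₁)] -/
def lemma13Beta : F := μ * lemma13Q ρ δ A C 1 / lemma13Q ρ δ A C 2

section D

variable (D : F →+* F)

/-- `D Q_i = Q_i(ρδ)` for `D` with `Dρ = ρ`, `Dδ = ρδ`, `DA = A`, `DC = C`. [folklore] -/
theorem D_lemma13Q (hDρ : D ρ = ρ) (hDδ : D δ = ρ * δ) (hDA : D A = A) (hDC : D C = C) (i : ℕ) :
    D (lemma13Q ρ δ A C i) = lemma13Q ρ (ρ * δ) A C i := by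
  simp only [lemma13Q, map_add, map_mul, map_pow, hDρ, hDδ, hDA, hDC]

variable (hρ : ρ ^ 2 + ρ + 1 = 0) (hDρ : D ρ = ρ) (hDδ : D δ = ρ * δ) (hDA : D A = A)
  (hDC : D C = C) (hDμ : D μ = μ)
include hρ hDρ hDδ hDA hDC hDμ

/-- **`β^D = m^{1/3} ϑ₁/ϑ₂`**: `D β = μ Q₀/Q₁`. [cite: Cassels1964ArithmeticVI, Lemma 1] -/
theorem D_lemma13Beta : D (lemma13Beta ρ δ A C μ) = μ * lemma13Q ρ δ A C 0 / lemma13Q ρ δ A C 1 := by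
  have hρ0 := rho_ne_zero hρ
  unfold lemma13Beta
  rw [map_div₀, map_mul, hDμ, D_lemma13Q D hDρ hDδ hDA hDC, D_lemma13Q D hDρ hDδ hDA hDC,
    lemma13Q_D_one hρ, lemma13Q_D_two hρ, mul_left_comm μ ρ, mul_div_mul_left _ _ hρ0]

/-- **`β^{D²} = m^{1/3} ϑ₃/ϑ₁`**: `D (D β) = μ Q₂/Q₀`. [cite: Cassels1964ArithmeticVI, Lemma 1] -/
theorem D_D_lemma13Beta : D (D (lemma13Beta ρ δ A C μ)) = μ * lemma13Q ρ δ A C 2 / lemma13Q ρ δ A C 0 := by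
  have hρ0 := rho_ne_zero hρ
  rw [D_lemma13Beta D hρ hDρ hDδ hDA hDC hDμ, map_div₀, map_mul, hDμ, D_lemma13Q D hDρ hDδ hDA hDC,
    D_lemma13Q D hDρ hDδ hDA hDC, lemma13Q_D_zero hρ, lemma13Q_D_one hρ, mul_left_comm μ ρ,
    mul_div_mul_left _ _ hρ0]

/-- **VI Lemma 1: "so that `Norm_d β = m`"** — `β · Dβ · D²β = μ³` (all `Q_i ≠ 0`).
[cite: Cassels1964ArithmeticVI, Lemma 1] -/
theorem norm_lemma13Beta (h0 : lemma13Q ρ δ A C 0 ≠ 0) (h1 : lemma13Q ρ δ A C 1 ≠ 0)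
    (h2 : lemma13Q ρ δ A C 2 ≠ 0) :
    lemma13Beta ρ δ A C μ * D (lemma13Beta ρ δ A C μ) * D (D (lemma13Beta ρ δ A C μ)) = μ ^ 3 := by
  rw [D_D_lemma13Beta D hρ hDρ hDδ hDA hDC hDμ, D_lemma13Beta D hρ hDρ hDδ hDA hDC hDμ, lemma13Beta]
  field_simp

/-- **VI Lemma 2 made explicit: `(T − 3d) · β^D/β^{D²} = Q₀³/(A²C)`**, `T = A²B + B²C + C²A`,
`d = ABC = δ³` — so `l β^{D−D²}` (`l = T − 3d` up to the factors `d τ³` and `D_m` of Cassels, which are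
units away from `3d`) is a cube times `A/C`, a unit away from `d`.
[cite: Cassels1964ArithmeticVI, Lemma 2] -/
theorem Xi_eq (hN : A * B * C = δ ^ 3) (hA : A ≠ 0) (hC : C ≠ 0) (hμ : μ ≠ 0)
    (h1 : lemma13Q ρ δ A C 1 ≠ 0) (h2 : lemma13Q ρ δ A C 2 ≠ 0) :
    (A ^ 2 * B + B ^ 2 * C + C ^ 2 * A - 3 * A * B * C) *
        (D (lemma13Beta ρ δ A C μ) / D (D (lemma13Beta ρ δ A C μ))) =
      lemma13Q ρ δ A C 0 ^ 3 / (A ^ 2 * C) := by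
  have hprod := prod_lemma13Q hρ hN (A := A) (B := B) (C := C)
  rw [D_D_lemma13Beta D hρ hDρ hDδ hDA hDC hDμ, D_lemma13Beta D hρ hDρ hDδ hDA hDC hDμ, div_div_div_eq,
    ← mul_div_assoc,
    div_eq_div_iff (mul_ne_zero h1 (mul_ne_zero hμ h2)) (mul_ne_zero (pow_ne_zero _ hA) hC)]
  linear_combination (-(μ * lemma13Q ρ δ A C 0 ^ 2)) * hprod

end D

/-- **"`β ∈ ℚ(ρ, d^{1/3})`" (VI Lemma 1): `β` is fixed by the operator `M`** — any ring endomorphism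
with `M ρ = ρ`, `M δ = δ`, `M A = B`, `M C = A`, `M μ = ρμ` (for `Δ ↦ Δ^M`, `m^{1/3} ↦ ρ m^{1/3}`),
given `ABC = δ³`. [cite: Cassels1964ArithmeticVI, Lemma 1] -/
theorem M_lemma13Beta (hρ : ρ ^ 2 + ρ + 1 = 0) (M : F →+* F) (hMρ : M ρ = ρ) (hMδ : M δ = δ) (hMA : M A = B) (hMC : M C = A)
    (hMμ : M μ = ρ * μ) (hN : A * B * C = δ ^ 3) (h2 : lemma13Q ρ δ A C 2 ≠ 0)
    (h2' : lemma13Q ρ δ B A 2 ≠ 0) :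
    M (lemma13Beta ρ δ A C μ) = lemma13Beta ρ δ A C μ := by
  have hid := lemma13Q_M hρ hN
  have hMQ : ∀ i, M (lemma13Q ρ δ A C i) = lemma13Q ρ δ B A i := fun i => by
    simp only [lemma13Q, map_add, map_mul, map_pow, hMρ, hMδ, hMA, hMC]
  simp only [lemma13Beta, map_div₀, map_mul, hMμ, hMQ]
  rw [div_eq_div_iff h2' h2]
  linear_combination μ * hid

end Lemma13

/-! ## §7 Lemma 7 (i): `v(μ(𝔵)) ≡ 0 (mod 3)` at primes not dividing `3` -/

section Lemma7

open WithZero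

variable {ρ : F} (v : Valuation F ℤᵐ⁰)

/-- In `ℤᵐ⁰`, `tⁿ = 1` with `n ≠ 0` forces `t = 1`. [folklore] -/
theorem eq_one_of_pow_eq_one' {t : ℤᵐ⁰} {n : ℕ} (hn : n ≠ 0) (h : t ^ n = 1) : t = 1 := by
  have ht : t ≠ 0 := by
    rintro rfl
    rw [zero_pow hn] at h
    exact zero_ne_one h
  have hl : log (t ^ n) = 0 := by rw [h, log_one]
  rw [log_pow, nsmul_eq_mul] at hl
  have hl' : log t = 0 := by
    rcases mul_eq_zero.mp hl with h' | h'
    · exact absurd (by exact_mod_cast h') hn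
    · exact h'
  rw [← exp_log ht, hl', exp_zero]

/-- `v(ρ) = 1` for a cube root of unity. [folklore] -/
theorem v_rho (hρ : ρ ^ 2 + ρ + 1 = 0) : v ρ = 1 := by
  have h : v ρ ^ 3 = 1 := by rw [← map_pow, rho_pow_three hρ, map_one]
  exact eq_one_of_pow_eq_one' (by norm_num) h

/-- `v(τ) = 1` when `v(3) = 1` (`τ² = −3`). [folklore] -/
theorem v_tau (hρ : ρ ^ 2 + ρ + 1 = 0) (h3 : v 3 = 1) : v (ρ - ρ ^ 2) = 1 := by
  have h : v (ρ - ρ ^ 2) ^ 2 = 1 := by rw [← map_pow, tau_sq hρ, Valuation.map_neg, h3]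
  exact eq_one_of_pow_eq_one' (by norm_num) h

/-- The ultrametric inequality in logarithms: `log v(a + b) ≤ max (log v a) (log v b)` for
`a, b, a + b ≠ 0`. [folklore] -/
theorem log_v_add_le {a b : F} (ha : a ≠ 0) (hb : b ≠ 0) (hab : a + b ≠ 0) :
    log (v (a + b)) ≤ max (log (v a)) (log (v b)) := by
  have hva : v a ≠ 0 := (Valuation.ne_zero_iff v).mpr ha
  have hvb : v b ≠ 0 := (Valuation.ne_zero_iff v).mpr hb
  have hvab : v (a + b) ≠ 0 := (Valuation.ne_zero_iff v).mpr hab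
  rcases le_max_iff.mp (Valuation.map_add v a b) with h | h
  · exact le_max_of_le_left ((log_le_log hvab hva).mpr h)
  · exact le_max_of_le_right ((log_le_log hvab hvb).mpr h)

/-- If `log v a < log v b` then `log v (a + b) = log v b`. [folklore] -/
theorem log_v_add_eq_of_lt {a b : F} (ha : a ≠ 0) (hb : b ≠ 0) (h : log (v a) < log (v b)) :
    log (v (a + b)) = log (v b) := by
  have hva : v a ≠ 0 := (Valuation.ne_zero_iff v).mpr ha
  have hvb : v b ≠ 0 := (Valuation.ne_zero_iff v).mpr hb
  have hlt : v a < v b := (log_lt_log hva hvb).mp h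
  rw [Valuation.map_add_eq_of_lt_right v hlt]

/-- From `a³ + b³ + c³ = 0`, `abc ≠ 0`: `log v a ≤ max (log v b) (log v c)` (and cyclically), so the
maximum of the three is attained twice ([I] p. 70: "By (8) the values `v_𝔓` of two of `x, y, ζ` are
equal and not greater than that of the third"). [cite: Cassels1959ArithmeticI, §7 Lemma 7 (proof, p. 70)] -/
theorem log_v_le_max_of_cube_sum {a b c : F} (habc : a ^ 3 + b ^ 3 + c ^ 3 = 0) (ha : a ≠ 0)
    (hb : b ≠ 0) (hc : c ≠ 0) : log (v a) ≤ max (log (v b)) (log (v c)) := by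
  have hva : v a ≠ 0 := (Valuation.ne_zero_iff v).mpr ha
  have hvb : v b ≠ 0 := (Valuation.ne_zero_iff v).mpr hb
  have hvc : v c ≠ 0 := (Valuation.ne_zero_iff v).mpr hc
  have hbc : b ^ 3 + c ^ 3 ≠ 0 := by
    intro h
    have : a ^ 3 = 0 := by linear_combination habc - h
    exact pow_ne_zero 3 ha this
  have e : v (a ^ 3) = v (b ^ 3 + c ^ 3) := by
    rw [show a ^ 3 = -(b ^ 3 + c ^ 3) by linear_combination habc, Valuation.map_neg]
  have h3 : 3 * log (v a) ≤ max (3 * log (v b)) (3 * log (v c)) := by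
    have := log_v_add_le v (pow_ne_zero 3 hb) (pow_ne_zero 3 hc) hbc
    rw [← e] at this
    simpa only [map_pow, log_pow, nsmul_eq_mul, Nat.cast_ofNat] using this
  rcases le_max_iff.mp h3 with h | h
  · exact le_max_of_le_left (by linarith)
  · exact le_max_of_le_right (by linarith)

/-- The basic case of Lemma 7 (i): if `log v b = log v c ≥ log v a` then `log v (a + b) = log v b`,
via `(a + b)(ρa + ρ²b)(ρ²a + ρb) = a³ + b³ = −c³` ([I] (9)–(11)).
[cite: Cassels1959ArithmeticI, §7 Lemma 7 (proof, (9)–(11))] -/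
theorem log_v_add_eq_of_cube_sum (hρ : ρ ^ 2 + ρ + 1 = 0) {a b c : F}
    (habc : a ^ 3 + b ^ 3 + c ^ 3 = 0) (ha : a ≠ 0) (hb : b ≠ 0) (hc : c ≠ 0)
    (hbc : log (v b) = log (v c)) (hab : log (v a) ≤ log (v b)) :
    log (v (a + b)) = log (v b) := by
  have hρ0 := rho_ne_zero hρ
  have hvρ := v_rho v hρ
  -- the three factors
  have hf : (a + b) * (ρ * a + ρ ^ 2 * b) * (ρ ^ 2 * a + ρ * b) = -c ^ 3 := by
    rw [sum_mul_u_mul_v hρ]; linear_combination habc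
  have hne1 : a + b ≠ 0 := by
    intro h; rw [h, zero_mul, zero_mul] at hf; exact pow_ne_zero 3 hc (by linear_combination hf)
  have hne2 : ρ * a + ρ ^ 2 * b ≠ 0 := by
    intro h; rw [h, mul_zero, zero_mul] at hf; exact pow_ne_zero 3 hc (by linear_combination hf)
  have hne3 : ρ ^ 2 * a + ρ * b ≠ 0 := by
    intro h; rw [h, mul_zero] at hf; exact pow_ne_zero 3 hc (by linear_combination hf)
  have hv1 : v (a + b) ≠ 0 := (Valuation.ne_zero_iff v).mpr hne1
  have hv2 : v (ρ * a + ρ ^ 2 * b) ≠ 0 := (Valuation.ne_zero_iff v).mpr hne2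
  have hv3 : v (ρ ^ 2 * a + ρ * b) ≠ 0 := (Valuation.ne_zero_iff v).mpr hne3
  -- each factor has `log v ≤ log v b`
  have la1 : log (v (ρ * a)) = log (v a) := by rw [map_mul, hvρ, one_mul]
  have la2 : log (v (ρ ^ 2 * a)) = log (v a) := by rw [map_mul, map_pow, hvρ, one_pow, one_mul]
  have lb1 : log (v (ρ * b)) = log (v b) := by rw [map_mul, hvρ, one_mul]
  have lb2 : log (v (ρ ^ 2 * b)) = log (v b) := by rw [map_mul, map_pow, hvρ, one_pow, one_mul]
  have l1 : log (v (a + b)) ≤ log (v b) := by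
    have := log_v_add_le v ha hb hne1
    exact this.trans (max_le hab le_rfl)
  have l2 : log (v (ρ * a + ρ ^ 2 * b)) ≤ log (v b) := by
    have := log_v_add_le v (mul_ne_zero hρ0 ha) (mul_ne_zero (pow_ne_zero _ hρ0) hb) hne2
    rw [la1, lb2] at this
    exact this.trans (max_le hab le_rfl)
  have l3 : log (v (ρ ^ 2 * a + ρ * b)) ≤ log (v b) := by
    have := log_v_add_le v (mul_ne_zero (pow_ne_zero _ hρ0) ha) (mul_ne_zero hρ0 hb) hne3
    rw [la2, lb1] at this
    exact this.trans (max_le hab le_rfl)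
  -- and the logs add up to `3 log v b`
  have hsum : log (v (a + b)) + log (v (ρ * a + ρ ^ 2 * b)) + log (v (ρ ^ 2 * a + ρ * b)) =
      3 * log (v b) := by
    have := congrArg (fun t => log (v t)) hf
    simp only [map_mul, Valuation.map_neg, map_pow, log_pow, nsmul_eq_mul, Nat.cast_ofNat] at this
    rw [log_mul (mul_ne_zero hv1 hv2) hv3, log_mul hv1 hv2] at this
    rw [this, hbc]
  linarith

/-- **[I] §7 Lemma 7 (i), core:** for a valuation `v` (into `ℤᵐ⁰`) with `v(3) = 1` and
`a³ + b³ + c³ = 0`, `abc ≠ 0`: if `log v b = log v c ≥ log v a` then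
`log v(a + b) = log v(a + c) = log v b` and `log v(b + c) ≡ log v b (mod 3)` — by (13)
`(a + b + c)³ = 3(a + b)(b + c)(c + a)`. [cite: Cassels1959ArithmeticI, §7 Lemma 7 (i) (proof, (9)–(14))] -/
theorem lemma7_core (hρ : ρ ^ 2 + ρ + 1 = 0) (h3 : v 3 = 1) {a b c : F}
    (habc : a ^ 3 + b ^ 3 + c ^ 3 = 0) (ha : a ≠ 0) (hb : b ≠ 0) (hc : c ≠ 0)
    (hbc : log (v b) = log (v c)) (hab : log (v a) ≤ log (v b)) :
    log (v (a + b)) = log (v b) ∧ log (v (a + c)) = log (v b) ∧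
      (3 : ℤ) ∣ log (v (b + c)) - log (v b) := by
  have e1 := log_v_add_eq_of_cube_sum v hρ habc ha hb hc hbc hab
  have habc' : a ^ 3 + c ^ 3 + b ^ 3 = 0 := by linear_combination habc
  have e2 := (log_v_add_eq_of_cube_sum v hρ habc' ha hc hb hbc.symm (hbc ▸ hab)).trans hbc.symm
  refine ⟨e1, e2, ?_⟩
  -- identity (13)
  have h13 : (a + b + c) ^ 3 = 3 * ((a + b) * (b + c) * (a + c)) := by linear_combination habc
  have hne_ab : a + b ≠ 0 := fun h => by
    have : c ^ 3 = 0 := by linear_combination habc - (a ^ 2 - a * b + b ^ 2) * h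
    exact pow_ne_zero 3 hc this
  have hne_ac : a + c ≠ 0 := fun h => by
    have : b ^ 3 = 0 := by linear_combination habc - (a ^ 2 - a * c + c ^ 2) * h
    exact pow_ne_zero 3 hb this
  have hne_bc : b + c ≠ 0 := fun h => by
    have : a ^ 3 = 0 := by linear_combination habc - (b ^ 2 - b * c + c ^ 2) * h
    exact pow_ne_zero 3 ha this
  have h30 : (3 : F) ≠ 0 := fun h => by rw [h, map_zero] at h3; exact zero_ne_one h3
  have hne_s : a + b + c ≠ 0 := fun h => by
    rw [h, zero_pow (by norm_num)] at h13
    exact mul_ne_zero h30 (mul_ne_zero (mul_ne_zero hne_ab hne_bc) hne_ac) h13.symm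
  have hv_ab : v (a + b) ≠ 0 := (Valuation.ne_zero_iff v).mpr hne_ab
  have hv_ac : v (a + c) ≠ 0 := (Valuation.ne_zero_iff v).mpr hne_ac
  have hv_bc : v (b + c) ≠ 0 := (Valuation.ne_zero_iff v).mpr hne_bc
  have := congrArg (fun t => log (v t)) h13
  simp only [map_mul, map_pow, log_pow, nsmul_eq_mul, Nat.cast_ofNat, h3, one_mul] at this
  rw [log_mul (mul_ne_zero hv_ab hv_bc) hv_ac, log_mul hv_ab hv_bc, e1, e2] at this
  exact ⟨log (v (a + b + c)) - log (v b), by linarith⟩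

/-- **[I] §7 Lemma 7 (i):** for a valuation `v` with `v(3) = 1` and `a³ + b³ + c³ = 0`, `abc ≠ 0`,
the values `v(a + b)`, `v(b + c)` agree modulo cubes: `3 ∣ log v(a + b) − log v(b + c)`.
("(7) `v(x + y) ≡ v(y + zδ) ≡ v(x + zδ) (mod 3)`.") [cite: Cassels1959ArithmeticI, §7 Lemma 7 (i), (7)] -/
theorem lemma7 (hρ : ρ ^ 2 + ρ + 1 = 0) (h3 : v 3 = 1) {a b c : F}
    (habc : a ^ 3 + b ^ 3 + c ^ 3 = 0) (ha : a ≠ 0) (hb : b ≠ 0) (hc : c ≠ 0) :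
    (3 : ℤ) ∣ log (v (a + b)) - log (v (b + c)) := by
  -- the maximum of the three logs is attained twice
  have hA := le_max_iff.mp (log_v_le_max_of_cube_sum v habc ha hb hc)
  have hB := le_max_iff.mp
    (log_v_le_max_of_cube_sum v (show b ^ 3 + c ^ 3 + a ^ 3 = 0 by linear_combination habc) hb hc ha)
  have hC := le_max_iff.mp
    (log_v_le_max_of_cube_sum v (show c ^ 3 + a ^ 3 + b ^ 3 = 0 by linear_combination habc) hc ha hb)
  set A := log (v a)
  set B := log (v b)
  set C := log (v c)
  have key : (B = C ∧ A ≤ B) ∨ (A = C ∧ B ≤ A) ∨ (A = B ∧ C ≤ A) := by omega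
  rcases key with ⟨h1, h2⟩ | ⟨h1, h2⟩ | ⟨h1, h2⟩
  · obtain ⟨e1, -, e3⟩ := lemma7_core v hρ h3 habc ha hb hc h1 h2
    obtain ⟨t, ht⟩ := e3
    exact ⟨-t, by rw [e1]; linarith⟩
  · -- roles: (b; a, c)
    obtain ⟨e1, e2, -⟩ := lemma7_core v hρ h3
      (show b ^ 3 + a ^ 3 + c ^ 3 = 0 by linear_combination habc) hb ha hc h1 h2
    rw [add_comm b a] at e1
    exact ⟨0, by rw [e1, e2]; ring⟩
  · -- roles: (c; a, b)
    obtain ⟨-, e2, e3⟩ := lemma7_core v hρ h3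
      (show c ^ 3 + a ^ 3 + b ^ 3 = 0 by linear_combination habc) hc ha hb h1 h2
    rw [add_comm c b] at e2
    obtain ⟨t, ht⟩ := e3
    exact ⟨t, by rw [e2]; linarith⟩

/-- **[I] §7 Lemma 7 (i) for `μ(𝔵) = τ(y + zδ)/(x + y)`:** at a valuation with `v(3) = 1`,
`3 ∣ log v(μ(𝔵))` whenever `x³ + y³ + dz³ = 0`, `δ³ = d`, `xyz δ ≠ 0`.
[cite: Cassels1959ArithmeticI, §7 Lemma 7 (i)] -/
theorem lemma7_mu (hρ : ρ ^ 2 + ρ + 1 = 0) (h3 : v 3 = 1) {x y z δ d : F} (hd : δ ^ 3 = d)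
    (hC : x ^ 3 + y ^ 3 + d * z ^ 3 = 0) (hx : x ≠ 0) (hy : y ≠ 0) (hz : z ≠ 0) (hδ : δ ≠ 0) :
    (3 : ℤ) ∣ log (v ((ρ - ρ ^ 2) * (y + z * δ) / (x + y))) := by
  have habc : x ^ 3 + y ^ 3 + (z * δ) ^ 3 = 0 := by rw [mul_pow, hd]; linear_combination hC
  have h := lemma7 v hρ h3 habc hx hy (mul_ne_zero hz hδ)
  have hne_xy : x + y ≠ 0 := fun h => by
    have : (z * δ) ^ 3 = 0 := by linear_combination habc - (x ^ 2 - x * y + y ^ 2) * h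
    exact mul_ne_zero hz hδ (pow_eq_zero_iff (n := 3) (by norm_num) |>.mp this)
  have hne_yz : y + z * δ ≠ 0 := fun h => by
    have : x ^ 3 = 0 := by linear_combination habc - (y ^ 2 - y * (z * δ) + (z * δ) ^ 2) * h
    exact pow_ne_zero 3 hx this
  have h30 : (3 : F) ≠ 0 := fun h => by rw [h, map_zero] at h3; exact zero_ne_one h3
  have hvτ : v (ρ - ρ ^ 2) ≠ 0 := (Valuation.ne_zero_iff v).mpr (tau_ne_zero hρ h30)
  have hvxy : v (x + y) ≠ 0 := (Valuation.ne_zero_iff v).mpr hne_xy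
  have hvyz : v (y + z * δ) ≠ 0 := (Valuation.ne_zero_iff v).mpr hne_yz
  rw [map_div₀, map_mul, log_div (mul_ne_zero hvτ hvyz) hvxy, log_mul hvτ hvyz, v_tau v hρ h3, log_one,
    zero_add]
  obtain ⟨t, ht⟩ := h
  exact ⟨-t, by linarith⟩

end Lemma7

end CasselsDescent

end Literature.NumberTheory.EllipticCurves
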